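import Summits.BirchSwinnertonDyer.BirchSwinnertonDyer.Theorems.EisensteinPrimesSurLambdaCaseCTC
import Summits.BirchSwinnertonDyer.BirchSwinnertonDyer.Theorems.SchneiderFreeAdditiveX3PoitouTateBidualTransport
import Literature.NumberTheory.IwasawaTheory.Greenberg2016.ShaDualityTowerOfPoitouTate
import HarnessLib

/-!
# Road «SUR-Λ» (crux 2 `GoodLatticeBDPValue`, by-name input #9 `Greenberg2016.prop263_sur_of_crk`),
# END-COMPOSE: Greenberg 2010 Prop. 3.2.1 (c) = Greenberg 2016 Prop. 2.6.3 (c) at totally complex `K`,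
# FROM the natural restricted Poitou–Tate Ш-duality (Milne ADT I Thm. 4.10 (a)) — kernel composition

Cell `bsd-eis`, width seat `bsd-line-x1-p1-w5` (gen 9); helper for stmt-BirchSwinnertonDyer-19032
(`--supports`, `--as helper`), road memo `SUR-LAMBDA-ROAD-w5g9.md` §2/§8.  THEOREMS ONLY (no definition,
no named fact, no `sorry`, no instance).

PRINT (R. Greenberg, *Surjectivity of the global-to-local map defining a Selmer group*, Kyoto J. Math.
50 (2010), Prop. 3.2.1 and its proof, p. 15 L19–32): "Suppose that `𝓛` is a specification for `𝐃` and
that CRK(𝐃, 𝓛) and LEO(𝐃) are both satisfied. Then SUR(𝐃, 𝓛) is satisfied if [(c)] there is an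
`η ∈ Σ` with `(T*)^{G_{K_η}} = 0` and `Q_𝓛(K_η, 𝐃)` divisible. … `Ш¹(K, Σ, T*)` is `Λ`-torsion [LEO(𝐃) and
the duality (6) between `Ш¹(K, Σ, T*)` and `Ш²(K, Σ, 𝐃)`, i.e. Poitou–Tate for the finite levels
`𝐃[𝔪ᵏ]`] … proposition 2.3.2 implies that `S_{𝓛*}(K, T*)` vanishes … proposition 3.1.1 implies that
`coker(φ_𝓛) = 0`."  R. Greenberg, *On the structure of Selmer groups* (2016), Prop. 2.6.3 (c) is the same
statement.  J. S. Milne, *Arithmetic Duality Theorems* I Thm. 4.10 (a) (p. 57) with the explicit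
description of the Ш-pairing (p. 65) is the one textbook input, carried BY NAME as the tree's named fact
`GaloisCohomology.poitouTate_shaRestricted_tateDual_natural`.

WHAT THIS FILE PROVES.  **`prop263_sur_of_crk_caseC_tc_of_poitouTateNatural`: if the natural restricted
Poitou–Tate Ш-duality `poitouTate_shaRestricted_tateDual_natural K` holds for every totally complex
number field `K`, then `Greenberg2016.prop263_sur_of_crk_caseC_tc`** (Greenberg's Prop. 2.6.3 (c) /
3.2.1 (c) with its binders verbatim, `K` totally complex) — the composition of the road's bricks, all
in the tree: the case-(c) assembly modulo (γ) `SurLambda.prop263_sur_of_crk_caseC_tc_of_dualSha_torsion`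
(brick (d)-1), step (γ) from the Ш-duality tower `Greenberg2016.dualSha_torsion_of_poitouTateNatural`
(bricks C7b-2…C7b-6), THE canonical local invariant maps (`invLevelLaw_canonical`,
`unramifiedOrthogonal_of_isPerfect_allLevels`, `canonical_isPerfect`), and two bookkeeping discharges
proved here from `Σ ⊇ {v ∣ p}`: the dual layers `Hom(𝐃[𝔪ᵏ], μ_{p^k})` are unramified outside `S`
(`isUnramifiedOutside_layerDualRep_torsionLayers`, via `isUnramifiedAt_tateDual`) and `#𝐃[𝔪ᵏ]` is a
power of `p`, hence supported on `S` (`mem_of_natCard_torsionBySet_mem`).  Also the variant from the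
all-fields form of the named fact (`…_of_poitouTateNatural'`).

HONESTY: no summit statement, crux or stub is proved here, and no Poitou–Tate duality: Milne I 4.10 (a)
(natural form) is the INPUT `hX`.  What the road achieves is that Greenberg's research-paper proposition
(case (c), `K` totally complex) is now a kernel theorem MODULO that one textbook theorem.  AI
formalisation, weaker than expert review; the statements are established only by the kernel check.

## References
* R. Greenberg, *Surjectivity of the global-to-local map defining a Selmer group*, Kyoto J. Math. 50
  (2010) 853–888, Prop. 3.2.1 (c) and its proof (p. 15 L19–32), §2.1 (6) p. 7. [Greenberg2010]
* R. Greenberg, *On the structure of Selmer groups*, Springer PROMS 188 (2016), Prop. 2.6.3 (c)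
  (§2.6 p. 10 L13–22). [Greenberg2016Selmer]
* J. S. Milne, *Arithmetic Duality Theorems*, 2nd ed. (2006), Ch. I, Thm. 4.10 (a) p. 57, §4 p. 65,
  §2 (unramified duals). [MilneADT2006]
-/

set_option linter.dupNamespace false

noncomputable section

open scoped Classical
open CategoryTheory Function NumberField IsDedekindDomain Field IsLocalRing
open _root_.ContinuousCohomology

namespace Summit.BirchSwinnertonDyer.BirchSwinnertonDyer.Theorems.SurLambda

open Literature.NumberTheory.GaloisRepresentations Literature.NumberTheory.GaloisCohomology
open Literature.NumberTheory.GaloisRepresentations.DiscreteGaloisModule.TorsionLayers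
open Literature.NumberTheory.IwasawaTheory.Greenberg2016
open Literature.NumberTheory.IwasawaTheory.Greenberg2006
open Summit.BirchSwinnertonDyer.BirchSwinnertonDyer.Theorems.SchneiderFreeAdditiveX3.PoitouTateReduction
  (unramifiedOrthogonal_of_isPerfect_allLevels isUnramifiedAt_tateDual)

variable {K : Type} [Field K] [NumberField K] {S : Set (HeightOneSpectrum (𝓞 K))}
  {Λ : Type} [CommRing Λ] [IsLocalRing Λ] [TopologicalSpace Λ]
  {D : Type} [AddCommGroup D] [Module Λ D] [TopologicalSpace D] [DiscreteTopology D]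
  [ContinuousSMul Λ D]
  (ρ : ContinuousRep (GaloisGroupUnramifiedOutside K S) Λ D)
  {p : ℕ} [Fact p.Prime] {m : ℕ}
  (e : Λ ≃+* MvPowerSeries (Fin m) ℤ_[p]) (hD : IsCofinitelyGenerated Λ D)

/-! ## §1. Bookkeeping from `Σ ⊇ {v ∣ p}` -/

omit [NumberField K] [TopologicalSpace Λ] [TopologicalSpace D] [DiscreteTopology D] [ContinuousSMul Λ D] in
/-- **`#𝐃[𝔪ᵏ]` is supported on `S` when `S ⊇ {v ∣ p}`**: `𝐃[𝔪ᵏ]` is a finite group killed by `p^k`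
(when `p ∈ 𝔪`, e.g. `Λ ≅ ℤ_p⟦T₁,…,T_m⟧`), hence of `p`-power order, and a prime `v` containing a power of `p` contains `p`.
[cite: Greenberg2010, §2 p. 6 L9–12] [cite: MilneADT2006, Ch. I, Thm. 4.10 (hypothesis "the order of `M` is a unit in `R_S`")] -/
theorem mem_of_natCard_torsionBySet_mem (hp : (p : Λ) ∈ maximalIdeal Λ)
    (hSp : ∀ w : HeightOneSpectrum (𝓞 K), ((p : ℕ) : 𝓞 K) ∈ w.asIdeal → w ∈ S) (k : ℕ)
    [Finite ↥(Submodule.torsionBySet Λ D ((maximalIdeal Λ ^ k : Ideal Λ) : Set Λ))]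
    (v : HeightOneSpectrum (𝓞 K))
    (hv : ((Nat.card ↥(Submodule.torsionBySet Λ D ((maximalIdeal Λ ^ k : Ideal Λ) : Set Λ)) : ℕ) : 𝓞 K) ∈
      v.asIdeal) :
    v ∈ S := by
  -- `p^k • x = 0` on `𝐃[𝔪ᵏ]`
  have htor : ∀ x : ↥(Submodule.torsionBySet Λ D ((maximalIdeal Λ ^ k : Ideal Λ) : Set Λ)),
      p ^ k • x = 0 := fun x => by
    apply Subtype.ext
    rw [Submodule.coe_smul_of_tower, Submodule.coe_zero, ← Nat.cast_smul_eq_nsmul Λ, Nat.cast_pow]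
    exact (Submodule.mem_torsionBySet_iff _ _).1 x.2
      ⟨(p : Λ) ^ k, Ideal.pow_mem_pow hp k⟩
  -- hence a `p`-group, of order `p^n`
  have hP : IsPGroup p
      (Multiplicative ↥(Submodule.torsionBySet Λ D ((maximalIdeal Λ ^ k : Ideal Λ) : Set Λ))) :=
    fun g => ⟨k, by rw [← ofAdd_toAdd g, ← ofAdd_nsmul, htor, ofAdd_zero]⟩
  obtain ⟨n, hn⟩ := hP.exists_card_eq
  have hn' : Nat.card ↥(Submodule.torsionBySet Λ D ((maximalIdeal Λ ^ k : Ideal Λ) : Set Λ)) = p ^ n :=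
    hn
  rw [hn', Nat.cast_pow] at hv
  exact hSp v (v.isPrime.mem_of_pow_mem n hv)

omit [ContinuousSMul Λ D] in
/-- **The dual layers `Hom(𝐃[𝔪ᵏ], μ_{p^k})` are unramified outside `S` when `S ⊇ {v ∣ p}`**: `𝐃[𝔪ᵏ]` is
inflated from `G_{K,Σ}` (`isUnramifiedAt_layerRep_torsionLayers`) and `μ_{p^k}` is unramified at
`w ∤ p` (`isUnramifiedAt_tateDual`). [cite: MilneADT2006, Ch. I §2 (before Thm. 2.6)] [cite: Greenberg2010, §3.1 p. 14 L21–26] -/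
theorem isUnramifiedOutside_layerDualRep_torsionLayers
    (hSp : ∀ w : HeightOneSpectrum (𝓞 K), ((p : ℕ) : 𝓞 K) ∈ w.asIdeal → w ∈ S) (k : ℕ) :
    GaloisRep.IsUnramifiedOutside S ((torsionLayers ρ e hD).layerDualRep k) := by
  intro w hw
  haveI : Finite ((torsionLayers ρ e hD).N k) := (torsionLayers ρ e hD).finite k
  have hpw : (((p ^ k : ℕ) : ℕ) : 𝓞 K) ∉ w.asIdeal := by
    rw [Nat.cast_pow]
    exact fun h => hw (hSp w (w.isPrime.mem_of_pow_mem k h))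
  exact isUnramifiedAt_tateDual ((torsionLayers ρ e hD).layerRep k) w hpw
    (isUnramifiedAt_layerRep_torsionLayers ρ e hD k hw)

/-! ## §2. The END theorem of road «SUR-Λ» -/

/-- **Greenberg 2016 Prop. 2.6.3 (c) / Greenberg 2010 Prop. 3.2.1 (c) at totally complex `K`, FROM the
natural restricted Poitou–Tate Ш-duality at totally complex fields** (Milne ADT I Thm. 4.10 (a), carried by
name as `poitouTate_shaRestricted_tateDual_natural`): the tree's case-(c) assembly modulo (γ)
(`prop263_sur_of_crk_caseC_tc_of_dualSha_torsion`) composed with (γ) from the Ш-duality tower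
(`dualSha_torsion_of_poitouTateNatural`) at THE canonical invariant maps, the two bookkeeping facts of §1
supplying its `hurD` / `hcard`. [cite: Greenberg2016Selmer, Prop. 2.6.3 (c) (§2.6 p. 10 L13–22)]
[cite: Greenberg2010, Prop. 3.2.1 (c) and proof (p. 15 L19–32)] [cite: MilneADT2006, Ch. I, Thm. 4.10 (a) p. 57, §4 p. 65] -/
theorem prop263_sur_of_crk_caseC_tc_of_poitouTateNatural
    (hX : ∀ (K : Type) [Field K] [NumberField K] [IsTotallyComplex K],
      poitouTate_shaRestricted_tateDual_natural K) :
    prop263_sur_of_crk_caseC_tc := by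
  refine prop263_sur_of_crk_caseC_tc_of_dualSha_torsion ?_
  intro p _ K _ _ _ S hS hSp Λ _ _ _ _ m e D _ _ _ _ _ ρ hD _hdiv hLEO y hy
  haveI : Finite (SigmaPlace S) := (finite_setOf_inSigma S hS).to_subtype
  haveI : CompactSpace (absoluteGaloisGroup K) := absoluteGaloisGroup_compactSpace _
  haveI : ∀ k : ℕ, Finite ↥(Submodule.torsionBySet Λ D ((maximalIdeal Λ ^ k : Ideal Λ) : Set Λ)) :=
    fun k => (torsionLayers ρ e hD).finite k
  exact dualSha_torsion_of_poitouTateNatural ρ e hD (hX K)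
    (isUnramifiedOutside_layerDualRep_torsionLayers ρ e hD hSp)
    (fun k v hv => mem_of_natCard_torsionBySet_mem
      (natCast_mem_maximalIdeal_of_ringEquiv_mvPowerSeries e) hSp k v hv)
    (fun k => LocalInvariants.canonical K (p ^ k))
    (fun v => invLevelLaw_canonical (K := K) (p := p) v)
    (fun k => unramifiedOrthogonal_of_isPerfect_allLevels _ LocalInvariants.canonical_isPerfect)
    hSp hLEO y hy

/-- The same from the named fact AS STATED (all number fields). [cite: MilneADT2006, Ch. I, Thm. 4.10 (a) p. 57]
[cite: Greenberg2016Selmer, Prop. 2.6.3 (c)] -/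
theorem prop263_sur_of_crk_caseC_tc_of_poitouTateNatural'
    (hX : ∀ (K : Type) [Field K] [NumberField K], poitouTate_shaRestricted_tateDual_natural K) :
    prop263_sur_of_crk_caseC_tc :=
  prop263_sur_of_crk_caseC_tc_of_poitouTateNatural fun K _ _ _ => hX K

end Summit.BirchSwinnertonDyer.BirchSwinnertonDyer.Theorems.SurLambda

end
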